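import Literature.AnabelianGeometry.AbsoluteAnabelian.FreeProcyclicStructure
import Literature.AnabelianGeometry.AbsoluteAnabelian.FreeProcyclicModel
import HarnessLib

/-!
# The "`≅ Ẑ`" / "`≅ Ẑ^Σ`" interface predicates are EXACTLY "isomorphic as a topological group to
# `∏_p ℤ_p`" / "to `∏_{p ∈ Σ} ℤ_p`" on profinite groups

Packaging of abc-iut-L4-t6's structure theorems (`FreeProcyclicStructure.lean`: a compact Hausdorff
totally disconnected group satisfying the predicate is `≃ₜ*` the model) with abc-iut-w5-d024's
converse (`FreeProcyclicModel.lean`: the models satisfy the predicates, which are transported along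
`≃ₜ*`): for a compact Hausdorff totally disconnected topological group `G`,

* `AbsTopII.isFreeProSigmaCyclic_iff_nonempty_continuousMulEquiv_padicSigmaProd`:
  `IsFreeProSigmaCyclic Σ G ↔ Nonempty (G ≃ₜ* Multiplicative (∏_{p ∈ Σ} ℤ_p))` — abc-iut-L4-t6's
  intrinsic typing of [AbsTopII] Prop. 1.3 (i) "as abstract profinite groups, `≅ Ẑ^Σ`" says exactly
  what print says;
* `FundamentalExtension.isFreeProcyclic_iff_nonempty_continuousMulEquiv_padicProd`:
  `IsFreeProcyclic G ↔ Nonempty (G ≃ₜ* Multiplicative (∏_p ℤ_p))` — abc-iut-L4-t1's intrinsic typing of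
  "`≅ Ẑ`" ([AbsTopIII] Prop. 1.4 (i), [AbsTopI] §0 p. 7) says exactly what print says;
* `AbsTopII.isFreeProSigmaCyclic_singleton_iff`: `IsFreeProSigmaCyclic {l} G ↔ Nonempty (G ≃ₜ*
  Multiplicative ℤ_l)` — the "`I ≅ ℤ_l`" conjunct of [AbsTopI] Lem. 4.5 (iv) as typed in
  `SatisfiesCuspidalCriterion`; closed-subgroup forms for inertia subgroups `I ⊆ Π`.

Proof-only; no definitions. Classical profinite group theory [cite: RibesZalesskii2010, Thm 2.7.1];
nothing here bears on [IUTchIII] Cor. 3.12.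
-/

noncomputable section

open Topology

namespace Literature.AnabelianGeometry.AbsoluteAnabelian

universe u

/-- The one-factor product `∏_{p ∈ {l}} ℤ_p` is `ℤ_l`: evaluation at the unique index is an
isomorphism of topological groups. [cite: RibesZalesskii2010, Thm 2.7.1] -/
theorem nonempty_continuousMulEquiv_padicSigmaProd_singleton (l : ℕ) [hl : Fact l.Prime] :
    Nonempty (Multiplicative (∀ p : {p : Nat.Primes // (p : ℕ) ∈ ({l} : Set ℕ)},
        @PadicInt (p.1 : ℕ) ⟨p.1.2⟩) ≃ₜ* Multiplicative ℤ_[l]) := by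
  let i₀ : {p : Nat.Primes // (p : ℕ) ∈ ({l} : Set ℕ)} := ⟨⟨l, hl.out⟩, rfl⟩
  have huniq : ∀ i : {p : Nat.Primes // (p : ℕ) ∈ ({l} : Set ℕ)}, i = i₀ :=
    fun i => Subtype.ext (Nat.Primes.coe_nat_injective (i.2.trans rfl))
  exact
    ⟨{ toFun := fun x => Multiplicative.ofAdd ((Multiplicative.toAdd x) i₀),
       invFun := fun y => Multiplicative.ofAdd (fun i => (huniq i).symm ▸ Multiplicative.toAdd y),
       left_inv := fun x => by
         change Multiplicative.ofAdd (fun i => _) = x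
         refine congrArg Multiplicative.ofAdd (funext fun i => ?_)
         cases huniq i; rfl,
       right_inv := fun y => rfl,
       map_mul' := fun _ _ => rfl,
       continuous_toFun := continuous_ofAdd.comp ((continuous_apply i₀).comp continuous_toAdd),
       continuous_invFun := by
         refine continuous_ofAdd.comp (continuous_pi fun i => ?_)
         cases huniq i
         exact continuous_toAdd }⟩

variable {G : Type u} [Group G] [TopologicalSpace G] [IsTopologicalGroup G] [CompactSpace G]
  [T2Space G] [TotallyDisconnectedSpace G]

/-- **[AbsTopII] Prop 1.3 (i)'s intrinsic typing is exact.** For a compact Hausdorff totally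
disconnected topological group, `IsFreeProSigmaCyclic Σ G` ("as abstract profinite groups, `≅ Ẑ^Σ`")
holds iff `G` is isomorphic as a topological group to `Ẑ^Σ = ∏_{p ∈ Σ} ℤ_p`.
[cite: MochizukiAbsTopII2013, Prop 1.3 (i) p.11] -/
theorem AbsTopII.isFreeProSigmaCyclic_iff_nonempty_continuousMulEquiv_padicSigmaProd {S : Set ℕ} :
    AbsTopII.IsFreeProSigmaCyclic S G ↔
      Nonempty (G ≃ₜ* Multiplicative (∀ p : {p : Nat.Primes // (p : ℕ) ∈ S},
        @PadicInt (p.1 : ℕ) ⟨p.1.2⟩)) := by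
  constructor
  · intro h
    obtain ⟨e, -⟩ := h.exists_continuousMulEquiv_padicSigmaProd
    exact ⟨e⟩
  · rintro ⟨e⟩
    exact (isFreeProSigmaCyclic_padicProdOn S).of_continuousMulEquiv e.symm

/-- **[AbsTopIII] Prop 1.4 (i) / [AbsTopI] §0: the intrinsic typing of "`≅ Ẑ`" is exact.** For a
compact Hausdorff totally disconnected topological group, `IsFreeProcyclic G` holds iff `G` is
isomorphic as a topological group to `Ẑ = ∏_p ℤ_p`. [cite: MochizukiAbsTopIII2015, Prop 1.4 (i) p.31] -/
theorem FundamentalExtension.isFreeProcyclic_iff_nonempty_continuousMulEquiv_padicProd :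
    FundamentalExtension.IsFreeProcyclic G ↔
      Nonempty (G ≃ₜ* Multiplicative (∀ p : Nat.Primes, @PadicInt (p : ℕ) ⟨p.2⟩)) := by
  constructor
  · intro h
    obtain ⟨e, -⟩ := h.exists_continuousMulEquiv_padicProd
    exact ⟨e⟩
  · rintro ⟨e⟩
    exact isFreeProcyclic_padicProd.of_continuousMulEquiv e.symm

/-- **The "`I ≅ ℤ_l`" conjunct of [AbsTopI] Lem 4.5 (iv) is exact** (`Σ = {l}`): for a compact
Hausdorff totally disconnected topological group, `IsFreeProSigmaCyclic {l} G ↔ G ≃ₜ* ℤ_l`.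
[cite: MochizukiAbsTopI2012, Lemma 4.5 (iv) p.54] -/
theorem AbsTopII.isFreeProSigmaCyclic_singleton_iff (l : ℕ) [Fact l.Prime] :
    AbsTopII.IsFreeProSigmaCyclic {l} G ↔ Nonempty (G ≃ₜ* Multiplicative ℤ_[l]) := by
  obtain ⟨f⟩ := nonempty_continuousMulEquiv_padicSigmaProd_singleton l
  rw [AbsTopII.isFreeProSigmaCyclic_iff_nonempty_continuousMulEquiv_padicSigmaProd]
  exact ⟨fun ⟨e⟩ => ⟨e.trans f⟩, fun ⟨e⟩ => ⟨e.trans f.symm⟩⟩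

/-- **Closed-subgroup form** (inertia subgroups `I_x ⊆ Π` of a profinite `Π`): a closed subgroup `I`
satisfies `IsFreeProcyclic I` iff `I ≃ₜ* Ẑ`. [cite: MochizukiAbsTopIII2015, Prop 1.4 (i) p.31] -/
theorem FundamentalExtension.isFreeProcyclic_iff_nonempty_continuousMulEquiv_padicProd_of_isClosed
    {I : Subgroup G} (hI : IsClosed (I : Set G)) :
    FundamentalExtension.IsFreeProcyclic I ↔
      Nonempty (I ≃ₜ* Multiplicative (∀ p : Nat.Primes, @PadicInt (p : ℕ) ⟨p.2⟩)) := by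
  haveI : CompactSpace I := isCompact_iff_compactSpace.mp hI.isCompact
  exact FundamentalExtension.isFreeProcyclic_iff_nonempty_continuousMulEquiv_padicProd

/-- **Closed-subgroup form, `Σ = {l}`** (the candidate subgroups `I ⊆ H_*` of
`SatisfiesCuspidalCriterion`, which are closed in the pro-`l` group `H_*`): a closed subgroup `I` of a
compact Hausdorff totally disconnected group satisfies `IsFreeProSigmaCyclic {l} I` iff `I ≃ₜ* ℤ_l`.
[cite: MochizukiAbsTopI2012, Lemma 4.5 (iv) p.54] -/
theorem AbsTopII.isFreeProSigmaCyclic_singleton_iff_of_isClosed {I : Subgroup G}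
    (hI : IsClosed (I : Set G)) (l : ℕ) [Fact l.Prime] :
    AbsTopII.IsFreeProSigmaCyclic {l} I ↔ Nonempty (I ≃ₜ* Multiplicative ℤ_[l]) := by
  haveI : CompactSpace I := isCompact_iff_compactSpace.mp hI.isCompact
  exact AbsTopII.isFreeProSigmaCyclic_singleton_iff l

end Literature.AnabelianGeometry.AbsoluteAnabelian
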